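import Summits.Ventures.DiscreteObjects.Hadamard.CentralizingInvolutions83and37
import Summits.Ventures.DiscreteObjects.Hadamard.Order167InvertingInvolution668

/-!
# H(668): an involution inverting an element of order 83 fixes 0, 4 or 12 rows (and as many columns); 12 means every
# orbit preserved and every fixed row of the element fixed (kernel window; HANDOFF-H-g21 item 3)

Framing: lottery ticket; floor = certified bounds/negative ranges.

Cell pub-namedobj (venture DiscreteObjects), target (H), hadamard gen 22.  The order-83 analogue of gen 21's
`Order167InvertingInvolution668`.  Let `σ = (π, κ, d, e)` be a signed automorphism of a Hadamard matrix `H` of order `668` with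
`π^83 = κ^83 = 1`, `(π, κ) ≠ (1,1)` (gen 5: exactly `4 + 4` fixed rows/columns and `8 + 8` orbits of length `83`), and
`τ = (π', κ', d', e')` a signed automorphism INVERTING it: `π'π = π^μ π'`, `κ'κ = κ^μ κ'`, `μ ≡ 82 (mod 83)`, whose pair is a
non-trivial involution.
* `inverting83_fixed_orbit_unique`, `card_fixed_moved_le_classes_of_inverting83`: on each `σ`-orbit of length `83` the
  inverting `τ` acts as `s ↦ −s + c` and has AT MOST ONE fixed point, so `#{x : τx = x, σx ≠ x} ≤ 8`;
  `fixed_stable_of_inverting83`, `card_fixed_fixed_mod_two'`: `τ` permutes the four `σ`-fixed rows, fixing `0, 2` or `4` of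
  them (an involution on a `4`-set).
* **`hadamard668_order83_inverting_involution`**: **`#Fix π' = #Fix κ' ∈ {0, 4, 12}`** [involution census (gen 13): `f ≡ 4
  (mod 8)`, `4 ≤ f ≤ 332`, or `f = 0`; here `f = f₀ + m` with `f₀ ∈ {0,2,4}`, `m ≤ 8`]; and **`f = 12` forces `m = 8`, `f₀ = 4`:
  `τ` maps every `σ`-moved row into its own `σ`-orbit and fixes each of the four `σ`-fixed rows** (the bordered
  symmetric-eight-circulant situation; `f = 4` leaves the splittings `4+0`, `2+2`, `0+4`).
WINDOW / STRUCTURE of a hypothetical object; no automorphism order and no Hadamard order is excluded; H(668) untouched;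
HITS 0/4.  Ours; no `sorry`, no definitions, default heartbeats.
-/

namespace Summit.Ventures.DiscreteObjects.Hadamard

open Finset BigOperators Matrix

open Literature.Combinatorics.Designs.GoethalsSeidel (IsHadamardMatrix)

variable {ι : Type*} [Fintype ι] [DecidableEq ι]

/-! ### tools: an inverting permutation at the prime 83 -/

/-- for an involution `ψ` mapping the fixed set of `π` to itself: the `ψ`-fixed `π`-fixed points have the parity of `#Fix π`
(variant of `card_fixed_fixed_mod_two` with the stability as hypothesis) -/
lemma card_fixed_fixed_mod_two' {π ψ : Equiv.Perm ι} (hstab : ∀ x, π (ψ x) = ψ x ↔ π x = x) (hψ : ψ ^ 2 = 1) :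
    ∃ k : ℕ, (univ.filter fun x => ψ x = x ∧ π x = x).card + 2 * k = (univ.filter fun x => π x = x).card := by
  set ρ : Equiv.Perm {x // π x = x} := ψ.subtypePerm hstab with hρ
  have hρ2 : ρ ^ 2 = 1 := by
    rw [hρ, Equiv.Perm.subtypePerm_pow]
    ext ⟨x, hx⟩
    change (ψ ^ 2) x = x
    rw [hψ, Equiv.Perm.one_apply]
  have hcl := card_fixed_add_classes ρ Nat.prime_two hρ2
  rw [Fintype.card_subtype] at hcl
  refine ⟨(blockClasses ρ 2).card, ?_⟩
  rw [← hcl, mul_comm]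
  congr 1
  rw [← Fintype.card_subtype, ← Fintype.card_subtype]
  refine Fintype.card_congr ((Equiv.subtypeEquivRight fun x => And.comm).trans
    ((Equiv.subtypeSubtypeEquivSubtypeInter (fun x => π x = x) (fun x => ψ x = x)).symm.trans
      (Equiv.subtypeEquivRight fun y => ?_)))
  rw [hρ, Subtype.ext_iff, Equiv.Perm.subtypePerm_apply]

section perm83
variable {π ψ : Equiv.Perm ι} {μ : ℕ} (hn : ψ * π = π ^ μ * ψ) (hπ : π ^ 83 = 1) (hμ : μ % 83 = 82)
include hn hπ hμ

omit [Fintype ι] [DecidableEq ι] hμ in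
/-- a permutation normalising `π` (exponent 83, any multiplier) maps `Fix π` onto itself -/
lemma fixed_stable_of_inverting83 (hcop : μ % 83 ≠ 0) : ∀ x, π (ψ x) = ψ x ↔ π x = x := by
  intro x
  constructor
  · intro h
    have h1 : ψ (π x) = ψ x := by
      rw [norm_apply hn x, perm_pow_apply_of_fixed π h μ]
    exact ψ.injective h1
  · intro h
    -- π^μ fixes ψ x; μ is prime to 83, so π fixes ψ x
    have h1 : (π ^ μ) (ψ x) = ψ x := by rw [← norm_apply hn x, h]
    have p83 : Nat.Prime 83 := by norm_num
    have hnd : ¬ 83 ∣ μ := fun h0 => hcop (Nat.mod_eq_zero_of_dvd h0)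
    obtain ⟨m, -, hm⟩ := Nat.exists_mul_mod_eq_one_of_coprime ((Nat.Prime.coprime_iff_not_dvd p83).mpr hnd).symm
      p83.one_lt
    have h2 : (π ^ (μ * m)) (ψ x) = ψ x := by rw [pow_mul]; exact perm_pow_apply_of_fixed _ h1 m
    rw [← pow_mod_of_pow_eq_one π hπ (μ * m), hm, pow_one] at h2
    exact h2

omit [Fintype ι] in
/-- two `ψ`-fixed points in one `π`-orbit of length `83` coincide (`ψ` acts on the orbit as `s ↦ −s + c`; `2` is invertible
mod `83`) -/
lemma inverting83_fixed_orbit_unique {x y : ι} (hxm : π x ≠ x) (hx : ψ x = x) (hy : ψ y = y)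
    (hmem : y ∈ orbFin π 83 x) : y = x := by
  have p83 : Nat.Prime 83 := by norm_num
  obtain ⟨k, hk, rfl⟩ := Finset.mem_image.mp hmem
  rw [Finset.mem_range] at hk
  rw [norm_apply_pow hn k x, hx, ← pow_mod_of_pow_eq_one π hπ (μ * k)] at hy
  have hk' : (μ * k) % 83 = k := perm_pow_apply_injective π p83 hπ hxm (Nat.mod_lt _ (by norm_num)) hk hy
  rw [Nat.mul_mod, hμ, Nat.mod_eq_of_lt hk] at hk'
  have hk0 : k = 0 := by omega
  rw [hk0, pow_zero, Equiv.Perm.one_apply]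

/-- hence `#{x : ψ x = x, π x ≠ x} ≤ #classes of π` -/
lemma card_fixed_moved_le_classes_of_inverting83 :
    (univ.filter fun x => ψ x = x ∧ π x ≠ x).card ≤ (blockClasses π 83).card := by
  refine Finset.card_le_card_of_injOn (fun x => orbFin π 83 x) ?_ ?_
  · intro x hx
    have hx' := (Finset.mem_filter.mp (Finset.mem_coe.mp hx)).2
    exact Finset.mem_coe.mpr (Finset.mem_image_of_mem _ (Finset.mem_filter.mpr ⟨Finset.mem_univ _, hx'.2⟩))
  · intro x hx y hy hxy
    have hx' := (Finset.mem_filter.mp (Finset.mem_coe.mp hx)).2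
    have hy' := (Finset.mem_filter.mp (Finset.mem_coe.mp hy)).2
    have hmem : y ∈ orbFin π 83 x := by
      have e : orbFin π 83 x = orbFin π 83 y := hxy
      rw [e]; exact mem_orbFin_self π (by norm_num) y
    exact (inverting83_fixed_orbit_unique hn hπ hμ hx'.2 hx'.1 hy'.1 hmem).symm

/-- if `ψ` fixes a point in as many orbits as `π` has classes, every orbit is preserved -/
lemma rows_preserved_of_card_fixed_moved83
    (hcard : (univ.filter fun x => ψ x = x ∧ π x ≠ x).card = (blockClasses π 83).card) :
    ∀ x, π x ≠ x → ψ x ∈ orbFin π 83 x := by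
  have p83 : Nat.Prime 83 := by norm_num
  have hinj : Set.InjOn (fun x => orbFin π 83 x) ↑(univ.filter fun x => ψ x = x ∧ π x ≠ x) := by
    intro x hx y hy hxy
    have hx' := (Finset.mem_filter.mp (Finset.mem_coe.mp hx)).2
    have hy' := (Finset.mem_filter.mp (Finset.mem_coe.mp hy)).2
    have hmem : y ∈ orbFin π 83 x := by
      have e : orbFin π 83 x = orbFin π 83 y := hxy
      rw [e]; exact mem_orbFin_self π (by norm_num) y
    exact (inverting83_fixed_orbit_unique hn hπ hμ hx'.2 hx'.1 hy'.1 hmem).symm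
  have hsub : (univ.filter fun x => ψ x = x ∧ π x ≠ x).image (fun x => orbFin π 83 x) ⊆ blockClasses π 83 := by
    intro C hC
    obtain ⟨x, hx, rfl⟩ := Finset.mem_image.mp hC
    exact Finset.mem_image_of_mem _ (Finset.mem_filter.mpr ⟨Finset.mem_univ _, (Finset.mem_filter.mp hx).2.2⟩)
  have heq : (univ.filter fun x => ψ x = x ∧ π x ≠ x).image (fun x => orbFin π 83 x) = blockClasses π 83 := by
    apply Finset.eq_of_subset_of_card_le hsub
    rw [Finset.card_image_of_injOn hinj, hcard]
  intro x hxm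
  have hC : orbFin π 83 x ∈ (univ.filter fun x => ψ x = x ∧ π x ≠ x).image (fun x => orbFin π 83 x) := by
    rw [heq]; exact Finset.mem_image_of_mem _ (Finset.mem_filter.mpr ⟨Finset.mem_univ _, hxm⟩)
  obtain ⟨y, hy, hyx⟩ := Finset.mem_image.mp hC
  have hy' := (Finset.mem_filter.mp hy).2
  have hxmem : x ∈ orbFin π 83 y := by
    have h : x ∈ orbFin π 83 x := mem_orbFin_self π (by norm_num) x
    rwa [← hyx] at h
  obtain ⟨k, -, rfl⟩ := Finset.mem_image.mp hxmem
  rw [norm_apply_pow hn k y, hy'.1, orbFin_eq_of_mem π p83 hπ hy'.2 hxmem]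
  exact pow_apply_mem_orbFin π (by norm_num) hπ y _

end perm83

/-! ### involutions inverting an element of order 83 -/

section main
variable {H : Matrix ι ι ℤ} (hH : IsHadamardMatrix H) (hι : Fintype.card ι = 668)
  {π κ π' κ' : Equiv.Perm ι} {d e d' e' : ι → ℤ} (haut : IsSignedAut H π κ d e)
  (hπ : π ^ 83 = 1) (hκ : κ ^ 83 = 1) (hne : π ≠ 1 ∨ κ ≠ 1)
  (haut' : IsSignedAut H π' κ' d' e') {μ : ℕ} (hnπ : π' * π = π ^ μ * π') (hnκ : κ' * κ = κ ^ μ * κ')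
  (hμ : μ % 83 = 82) (h2 : π' ^ 2 = 1) (h2' : κ' ^ 2 = 1) (hne' : π' ≠ 1 ∨ κ' ≠ 1)
include hH hι haut hπ hκ hne haut' hnπ hnκ hμ h2 h2' hne'

omit hH hι haut hκ hne haut' hnκ h2' hne' in
/-- the count on one side: `#Fix π' = f₀ + m` with `f₀ + 2k = #Fix π` and `m ≤ #classes of π` -/
lemma inverting83_count : ∃ f₀ m k : ℕ, f₀ + 2 * k = (univ.filter fun x => π x = x).card ∧
    m ≤ (blockClasses π 83).card ∧ (univ.filter fun x => π' x = x).card = f₀ + m ∧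
    f₀ = (univ.filter fun x => π' x = x ∧ π x = x).card ∧ m = (univ.filter fun x => π' x = x ∧ π x ≠ x).card := by
  have hstab := fixed_stable_of_inverting83 hnπ hπ (by rw [hμ]; norm_num)
  obtain ⟨k, hk⟩ := card_fixed_fixed_mod_two' hstab h2
  exact ⟨_, _, k, hk, card_fixed_moved_le_classes_of_inverting83 hnπ hπ hμ, card_fixed_split π π', rfl, rfl⟩

/-- **Involutions inverting an element of order 83 fix `0`, `4` or `12` rows (and as many columns); `12` forces every
`σ`-orbit of rows to be preserved and every `σ`-fixed row to be fixed.** -/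
theorem hadamard668_order83_inverting_involution :
    (univ.filter fun x => π' x = x).card = (univ.filter fun y => κ' y = y).card ∧
    ((univ.filter fun x => π' x = x).card = 0 ∨ (univ.filter fun x => π' x = x).card = 4 ∨
      (univ.filter fun x => π' x = x).card = 12) ∧
    ((univ.filter fun x => π' x = x).card = 12 →
      (∀ x, π x ≠ x → π' x ∈ orbFin π 83 x) ∧ (∀ x, π x = x → π' x = x) ∧
      (∀ y, κ y ≠ y → κ' y ∈ orbFin κ 83 y) ∧ (∀ y, κ y = y → κ' y = y)) := by
  have p83 : Nat.Prime 83 := by norm_num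
  have h83 := hadamard668_fixedRows_83 hH hι π κ d e haut hπ hκ hne
  -- class counts: 4 + 83 c = 668 ⇒ c = 8
  have hclπ := card_fixed_add_classes π p83 hπ
  have hclκ := card_fixed_add_classes κ p83 hκ
  rw [h83.1, hι] at hclπ
  rw [h83.2, hι] at hclκ
  have hcπ : (blockClasses π 83).card = 8 := by omega
  have hcκ : (blockClasses κ 83).card = 8 := by omega
  obtain ⟨f₀, m, k, hk, hm, hf, hf₀, hmm⟩ := inverting83_count hπ hnπ hμ h2
  obtain ⟨g₀, n, l, hl, hn, hg, hg₀, hnn⟩ := inverting83_count hκ hnκ hμ h2'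
  rw [h83.1] at hk
  rw [h83.2] at hl
  rw [hcπ] at hm
  rw [hcκ] at hn
  obtain ⟨-, -, hcases⟩ := hadamard668_involution_census_final hH hι π' κ' d' e' haut' h2 h2' hne'
  rcases hcases with ⟨heq, hmod8, h4, -, -⟩ | ⟨h0, h0', -, -⟩
  · refine ⟨heq, Or.inr (by omega), fun h12 => ?_⟩
    have hm8 : m = 8 := by omega
    have hf4 : f₀ = 4 := by omega
    have hn8 : n = 8 := by omega
    have hg4 : g₀ = 4 := by omega
    refine ⟨rows_preserved_of_card_fixed_moved83 hnπ hπ hμ (by rw [← hmm, hm8, hcπ]), fun x hx => ?_,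
      rows_preserved_of_card_fixed_moved83 hnκ hκ hμ (by rw [← hnn, hn8, hcκ]), fun y hy => ?_⟩
    · -- the π'-fixed π-fixed rows are all four π-fixed rows
      have hsub : (univ.filter fun x => π' x = x ∧ π x = x) ⊆ univ.filter fun x => π x = x := by
        intro z hz; exact Finset.mem_filter.mpr ⟨Finset.mem_univ _, (Finset.mem_filter.mp hz).2.2⟩
      have heq' := Finset.eq_of_subset_of_card_le hsub (by rw [← hf₀, hf4, h83.1])
      have hx' : x ∈ univ.filter fun x => π x = x := Finset.mem_filter.mpr ⟨Finset.mem_univ _, hx⟩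
      rw [← heq'] at hx'
      exact (Finset.mem_filter.mp hx').2.1
    · have hsub : (univ.filter fun y => κ' y = y ∧ κ y = y) ⊆ univ.filter fun y => κ y = y := by
        intro z hz; exact Finset.mem_filter.mpr ⟨Finset.mem_univ _, (Finset.mem_filter.mp hz).2.2⟩
      have heq' := Finset.eq_of_subset_of_card_le hsub (by rw [← hg₀, hg4, h83.2])
      have hy' : y ∈ univ.filter fun y => κ y = y := Finset.mem_filter.mpr ⟨Finset.mem_univ _, hy⟩
      rw [← heq'] at hy'
      exact (Finset.mem_filter.mp hy').2.1
  · refine ⟨by rw [h0, h0'], Or.inl h0, fun h12 => ?_⟩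
    rw [h0] at h12
    exact absurd h12 (by norm_num)

end main

end Summit.Ventures.DiscreteObjects.Hadamard
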